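/-
Copyright (c) 2026 the pub-hodgecm-mathlib formalisation cell (harness21).  Prover seat hodgecm-mathlib-K2E4-p14 (g5), Track B ∕ K2-LIT, h413 =
`stmt-HodgeConjecture-24833`, line `K2_E1_TraceFormulaBeta`, campaign «EIS-RANK-ONE» rung R6f(ii); «CM-FINAL» of the «EIS-R6-CM» chain (offered to the dealer K2E1-plan (g4)
2026-09-04T06:3xZ after ★ ED. 6 p857898; silence = «=» per the standing orders §F g3-v2).
-/
import Summits.HodgeConjecture.HodgeConjecture.Theorems.K2E1IntertwiningGrowthU3               -- ★ p857898 (this seat): ED. 6 `maassSelberg_flatSectionU_three_fin`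
import Summits.HodgeConjecture.HodgeConjecture.Theorems.K2E1TruncatedEisensteinBoundedCMThree    -- ★ p857707 (K2E4-p11 g3): `hΛm`, `hΛG`, `hΛbdd` at CM modulo `hdec`
import Summits.HodgeConjecture.HodgeConjecture.Theorems.K2E1EisensteinAnalyticBinders            -- ★ p857653 (K2E1-p09 g4): `hfin_of_locallyUniformMajorant`, `integrableOn_translate_of_continuous`
import Summits.HodgeConjecture.HodgeConjecture.Theorems.K2E1MaassSelbergCMThreePairingsFin         -- ★ p858076 (K2E4-p14 g6): ED. 7 `maassSelberg_flatSectionU_three_pair` — `hψL1 hi₅ habs habs′` discharged (ED. 2)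
import Summits.HodgeConjecture.HodgeConjecture.Theorems.K2E1HeisenbergHaarU3                      -- ★ p857935 (K2-defs1 g4): (ν-2) `isInvInvariant_of_isHaarMeasure_adelicUnipotent_three` (ED. 2)
import HarnessLib

/-!
# K2·E1 — `K2E1MaassSelbergCMThreeFinal`: THE MAASS–SELBERG RELATION FOR FLAT SECTIONS OF `U(J₃)` AT THE CM PAIR `(L⁺, L, conj)`, EVERY STRUCTURAL AND GODEMENT INPUT DISCHARGED BY NAME
# (campaign «EIS-RANK-ONE», rung R6f(ii): ★ ED. 6 `maassSelberg_flatSectionU_three_fin` at CM with `hfinz`, `hfinz′`, `hint′`, `hsum`, `hΛm`, `hΛG`, `hΛbdd`, `h2`, `hc`, `hc1`, `hBK` discharged)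

Track B ∕ K2-LIT, crux h413 = `stmt-HodgeConjecture-24833`, route of record `HCCMUnconditional`; cell `hodgecm-mathlib`, squad K2, ENGINE E1.  Prover seat
`hodgecm-mathlib-K2E4-p14` (g5).  THEOREMS ONLY (no `def`, no `instance`, no notation, no named-fact hypothesis, no `sorry`); lane `--supports stmt-HodgeConjecture-24833 --as helper`
(count-neutral).  Closes no socket.

THE MATHEMATICS [MoeglinWaldspurger1995, II.1.5–II.1.7, IV.2.1–IV.2.3; Arthur1980TraceFormulaII, §4; Garrett2018, §11.3].  At the CM pair (`F = L⁺`, `E = L`, `c = conj`) the generic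
inputs of ★ ED. 6 are theorems of the tree: `[L:L⁺] = 2`, `conj² = 1 ≠ conj` (Mathlib), the Iwasawa decomposition ★ `exists_mem_borelAdelic_mul_mem_standardMaximalCompactGL_cm_three`,
the Godement finiteness of the standard sections `H^z`, `H^{z′}` in ★ R3's spelling (★ `hfin_of_locallyUniformMajorant` + ★ `exists_locallyUniform_majorant_flatSectionU_cm_three`, `Re > 2`,
for a fundamental domain `𝓕` of `N(L⁺)` with COMPACT CLOSURE), the integrability of `u ↦ E(f′_{z′})(u g)` on `𝓕` (★ `integrableOn_translate_of_continuous` + ★ R4a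
`continuous_eisensteinSeriesU_flatSectionU_cm_three`, `φ′` continuous), the summability `hsum` (★ `summable_flatSectionU_cm_three`), and the truncated second series
`Λ′ = Λ^T E(f′_{z′})`: Borel (★ `measurable_truncation_eisensteinSeriesU_flatSectionU_cm_three′`), `G(L⁺)`-invariant (★ `truncation_eisensteinSeriesU_flatSectionU_arithmeticSubgroup_mul`)
and bounded MODULO the decay `hdec′` (★ `exists_norm_truncation_eisensteinSeriesU_flatSectionU_le_cm_three`).
**`maassSelberg_flatSectionU_cm_three_final`**: for continuous bounded left-`N(𝔸)`∕`B(L⁺)`-invariant coefficients `φ, φ′` on the sub-tube `2 < Re z′ < Re z`, the relation of ★ ED. 6 with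
NAMED INPUTS EXACTLY: `hdec′` (the decay of `E(f′) − E(f′)_B` on `{H > T}`, the [D2] chain), `hψL1`, `hi₅`, `habs`, `habs′` (absolute convergence of the four pairings), `hΞ₁…hΞ₄` (the
`K_U`-averages of the coefficient pairs pushed to `𝕀_L`).
HONEST LABEL: HC_CM is proved only modulo the 7 printed citations (2 remaining named inputs: hLiu418 = `stmt-HodgeConjecture-24832`, h413 = `stmt-HodgeConjecture-24833`) until rung 0
closes; this file asserts no named fact and closes no socket.
References: [MoeglinWaldspurger1995] II.1.5–II.1.7, IV.2.1–IV.2.3 · [Arthur1980TraceFormulaII] §4 · [Garrett2018] §2.8, §11.3 · [Godement1964] §8 · [Rogawski1990] §2.2, §7.3.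
-/

set_option autoImplicit false
-- the mandated namespace repeats the single-problem summit's segment (`HodgeConjecture.HodgeConjecture`)
set_option linter.dupNamespace false

noncomputable section

open MeasureTheory Measure NumberField IsDedekindDomain Set MulAction Filter Topology
open scoped ENNReal NNReal ComplexConjugate
open Literature.MeasureTheory.Group Literature.NumberTheory
open Literature.NumberTheory.Automorphic Literature.NumberTheory.Automorphic.UnitaryGroup AdelicGroupData
open Summit.HodgeConjecture.HodgeConjecture.Cruxes.H413.K2E1BorelEisensteinU
open Summit.HodgeConjecture.HodgeConjecture.Cruxes.H413.K2E1MaassSelbergBracketsThree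
open Summit.HodgeConjecture.HodgeConjecture.Cruxes.H413.K2E1MaassSelbergCMThree (summable_flatSectionU_cm_three)
open Summit.HodgeConjecture.HodgeConjecture.Cruxes.H413.K2E1IntertwiningGrowthU3 (maassSelberg_flatSectionU_three_fin)
open Summit.HodgeConjecture.HodgeConjecture.Cruxes.H413.K2E1TruncatedEisensteinBoundedCMThree
open Summit.HodgeConjecture.HodgeConjecture.Cruxes.H413.K2E1EisensteinAnalyticBinders (hfin_of_locallyUniformMajorant integrableOn_translate_of_continuous)
open Summit.HodgeConjecture.HodgeConjecture.Cruxes.H413.K2E1BorelEisensteinGodementCMThree (exists_locallyUniform_majorant_flatSectionU_cm_three)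
open Summit.HodgeConjecture.HodgeConjecture.Cruxes.H413.K2E1BorelEisensteinRegularCMThree (continuous_eisensteinSeriesU_flatSectionU_cm_three)
open Summit.HodgeConjecture.HodgeConjecture.Cruxes.H413.K2E1BorelCosetsDictionary (forall_arithmeticBorel_iff)

namespace Summit.HodgeConjecture.HodgeConjecture.Cruxes.H413.K2E1MaassSelbergCMThreeFinal

variable (L : Type) [Field L] [NumberField L] [IsCMField L]
variable [MeasurableSpace (quasiSplit (↥(maximalRealSubfield L)) L (IsCMField.complexConj L) 3).Adelic] [BorelSpace (quasiSplit (↥(maximalRealSubfield L)) L (IsCMField.complexConj L) 3).Adelic]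
variable [MeasurableSpace (AdeleRing (𝓞 L) L)ˣ] [BorelSpace (AdeleRing (𝓞 L) L)ˣ]

/-- **THE MAASS–SELBERG RELATION FOR FLAT SECTIONS OF `U(J₃)` AT THE CM PAIR, EVERY STRUCTURAL∕GODEMENT INPUT DISCHARGED BY NAME** (see the module docstring for the discharge
table).  Hypotheses, in order: the automorphic measure `μ`, Haar measures `ν_G` (inversion-invariant), `μ_K`, `ν_I`, an idele class domain `𝓕_I`; a Haar measure `ν` on `N(𝔸_{L⁺})`
(inversion-invariant), a fundamental domain `𝓕` of `N(L⁺)` with `ν(𝓕) = 1` AND COMPACT CLOSURE; then a covering weight `β`, `T ≥ 1`, continuous bounded left-`N(𝔸)`∕`B(L⁺)`-invariant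
`φ, φ′`, the sub-tube `2 < Re z′ < Re z`, the decay `hdec′`, `hψL1`, `hi₅`, `habs`, `habs′`, the four `K_U`-average data `Ξᵢ`; conclusion verbatim ★ ED. 6's.
[cite: MoeglinWaldspurger1995, II.1.5–II.1.7 and IV.2.1–IV.2.3] [cite: Arthur1980TraceFormulaII, §4] [cite: Garrett2018, §11.3] -/
theorem maassSelberg_flatSectionU_cm_three_final
    (μ : Measure (quasiSplit (↥(maximalRealSubfield L)) L (IsCMField.complexConj L) 3).automorphicQuotient) [(quasiSplit (↥(maximalRealSubfield L)) L (IsCMField.complexConj L) 3).IsAutomorphicMeasure μ]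
    (νG : Measure (quasiSplit (↥(maximalRealSubfield L)) L (IsCMField.complexConj L) 3).Adelic) [νG.IsHaarMeasure] [νG.IsInvInvariant]
    (μK : Measure ((standardMaximalCompactGL 3 L).comap (adelicVal (↥(maximalRealSubfield L)) L (IsCMField.complexConj L) 3 ((StdForm.antidiagonal 3).over L)) : Subgroup (quasiSplit (↥(maximalRealSubfield L)) L (IsCMField.complexConj L) 3).Adelic))
    [μK.IsHaarMeasure]
    (νI : Measure (AdeleRing (𝓞 L) L)ˣ) [νI.IsHaarMeasure]
    {𝓕I : Set (AdeleRing (𝓞 L) L)ˣ} (h𝓕I : IsIdeleClassDomain L 𝓕I)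
    (ν : Measure ↥(adelicUnipotent (↥(maximalRealSubfield L)) L (IsCMField.complexConj L) 3)) [ν.IsHaarMeasure] [ν.IsInvInvariant]
    {𝓕 : Set ↥(adelicUnipotent (↥(maximalRealSubfield L)) L (IsCMField.complexConj L) 3)} (h𝓕N : IsFundamentalDomain ↥(rationalUnipotent (↥(maximalRealSubfield L)) L (IsCMField.complexConj L) 3) 𝓕 ν) (h𝓕1 : ν 𝓕 = 1) (h𝓕c : IsCompact (closure 𝓕)) :
    ∃ cμ K : ℝ, 0 < cμ ∧ 0 < K ∧
      ∀ {β : (quasiSplit (↥(maximalRealSubfield L)) L (IsCMField.complexConj L) 3).Adelic → ℝ≥0∞}, IsCoveringWeight ((arithmeticBorel (↥(maximalRealSubfield L)) L (IsCMField.complexConj L) 3).map (quasiSplit (↥(maximalRealSubfield L)) L (IsCMField.complexConj L) 3).arithmeticSubgroup.subtype) β →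
      ∀ {T : ℝ≥0}, 1 ≤ T →
      ∀ {φ φ' : (quasiSplit (↥(maximalRealSubfield L)) L (IsCMField.complexConj L) 3).Adelic → ℂ},
      Continuous φ →
        (∀ (n : unipotentInBorel (↥(maximalRealSubfield L)) L (IsCMField.complexConj L) 3) (y : (quasiSplit (↥(maximalRealSubfield L)) L (IsCMField.complexConj L) 3).Adelic), φ (((n : borelAdelic (↥(maximalRealSubfield L)) L (IsCMField.complexConj L) 3) : (quasiSplit (↥(maximalRealSubfield L)) L (IsCMField.complexConj L) 3).Adelic) * y) = φ y) →
        (∀ b ∈ arithmeticBorel (↥(maximalRealSubfield L)) L (IsCMField.complexConj L) 3, ∀ y : (quasiSplit (↥(maximalRealSubfield L)) L (IsCMField.complexConj L) 3).Adelic, φ ((b : (quasiSplit (↥(maximalRealSubfield L)) L (IsCMField.complexConj L) 3).Adelic) * y) = φ y) →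
      ∀ {Cφ : ℝ}, (∀ x, ‖φ x‖ ≤ Cφ) →
      Continuous φ' →
        (∀ (n : unipotentInBorel (↥(maximalRealSubfield L)) L (IsCMField.complexConj L) 3) (y : (quasiSplit (↥(maximalRealSubfield L)) L (IsCMField.complexConj L) 3).Adelic), φ' (((n : borelAdelic (↥(maximalRealSubfield L)) L (IsCMField.complexConj L) 3) : (quasiSplit (↥(maximalRealSubfield L)) L (IsCMField.complexConj L) 3).Adelic) * y) = φ' y) →
        (∀ b ∈ arithmeticBorel (↥(maximalRealSubfield L)) L (IsCMField.complexConj L) 3, ∀ y : (quasiSplit (↥(maximalRealSubfield L)) L (IsCMField.complexConj L) 3).Adelic, φ' ((b : (quasiSplit (↥(maximalRealSubfield L)) L (IsCMField.complexConj L) 3).Adelic) * y) = φ' y) →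
      ∀ {Cφ' : ℝ}, (∀ x, ‖φ' x‖ ≤ Cφ') →
      ∀ {z z' : ℂ}, 2 < z'.re → z'.re < z.re →
      -- NAMED: the decay `hdec′` of `E(f′_{z′}) − E(f′_{z′})_B` on the Siegel region `{H > T}` ([D2] chain ⟹ `hΛbdd` via ★ p857707), the four absolute convergences, the `K_U`-averages
        ∀ {M₁ : ℝ}, (∀ g : (quasiSplit (↥(maximalRealSubfield L)) L (IsCMField.complexConj L) 3).Adelic, T < borelHeight g →
          ‖eisensteinSeriesU (flatSectionU φ' z') g - borelConstantTerm ν 𝓕 (eisensteinSeriesU (flatSectionU φ' z')) g‖ ≤ M₁) →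
        ∫⁻ g, β g * ‖({y : (quasiSplit (↥(maximalRealSubfield L)) L (IsCMField.complexConj L) 3).Adelic | borelHeight y ≤ T}.indicator (flatSectionU φ z) g - {y : (quasiSplit (↥(maximalRealSubfield L)) L (IsCMField.complexConj L) 3).Adelic | T < borelHeight y}.indicator (flatSectionU (fun g : (quasiSplit (↥(maximalRealSubfield L)) L (IsCMField.complexConj L) 3).Adelic => (∫ v : ↥(adelicUnipotent (↥(maximalRealSubfield L)) L (IsCMField.complexConj L) 3), flatSectionU φ z ((quasiSplit (↥(maximalRealSubfield L)) L (IsCMField.complexConj L) 3).toAdelic (weylLongU ((IsCMField.complexConj L : L ≃ₐ[↥(maximalRealSubfield L)] L) : L →+* L) (rfl : (StdForm.antidiagonal 3).over L = (StdForm.antidiagonal 3).over L)) * ((v : (quasiSplit (↥(maximalRealSubfield L)) L (IsCMField.complexConj L) 3).Adelic) * g)) ∂ν) * ((borelHeight g : ℝ) : ℂ) ^ (z - 2)) (2 - z)) g)‖ₑ ∂νG < ∞ →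
        Integrable (fun g => (β g).toReal • (({y : (quasiSplit (↥(maximalRealSubfield L)) L (IsCMField.complexConj L) 3).Adelic | borelHeight y ≤ T}.indicator (flatSectionU φ z) g - {y : (quasiSplit (↥(maximalRealSubfield L)) L (IsCMField.complexConj L) 3).Adelic | T < borelHeight y}.indicator (flatSectionU (fun g : (quasiSplit (↥(maximalRealSubfield L)) L (IsCMField.complexConj L) 3).Adelic => (∫ v : ↥(adelicUnipotent (↥(maximalRealSubfield L)) L (IsCMField.complexConj L) 3), flatSectionU φ z ((quasiSplit (↥(maximalRealSubfield L)) L (IsCMField.complexConj L) 3).toAdelic (weylLongU ((IsCMField.complexConj L : L ≃ₐ[↥(maximalRealSubfield L)] L) : L →+* L) (rfl : (StdForm.antidiagonal 3).over L = (StdForm.antidiagonal 3).over L)) * ((v : (quasiSplit (↥(maximalRealSubfield L)) L (IsCMField.complexConj L) 3).Adelic) * g)) ∂ν) * ((borelHeight g : ℝ) : ℂ) ^ (z - 2)) (2 - z)) g) * conj (∫ u : ↥(adelicUnipotent (↥(maximalRealSubfield L)) L (IsCMField.complexConj L) 3), {y : (quasiSplit (↥(maximalRealSubfield L)) L (IsCMField.complexConj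 L) 3).Adelic | T < borelHeight y}.indicator (flatSectionU φ' z' + flatSectionU (fun g : (quasiSplit (↥(maximalRealSubfield L)) L (IsCMField.complexConj L) 3).Adelic => (∫ v : ↥(adelicUnipotent (↥(maximalRealSubfield L)) L (IsCMField.complexConj L) 3), flatSectionU φ' z' ((quasiSplit (↥(maximalRealSubfield L)) L (IsCMField.complexConj L) 3).toAdelic (weylLongU ((IsCMField.complexConj L : L ≃ₐ[↥(maximalRealSubfield L)] L) : L →+* L) (rfl : (StdForm.antidiagonal 3).over L = (StdForm.antidiagonal 3).over L)) * ((v : (quasiSplit (↥(maximalRealSubfield L)) L (IsCMField.complexConj L) 3).Adelic) * g)) ∂ν) * ((borelHeight g : ℝ) : ℂ) ^ (z' - 2)) (2 - z')) ((quasiSplit (↥(maximalRealSubfield L)) L (IsCMField.complexConj L) 3).toAdelic (weylLongU ((IsCMField.complexConj L : L ≃ₐ[↥(maximalRealSubfield L)] L) : L →+* L) (rfl : (StdForm.antidiagonal 3).over L = (StdForm.antidiagonal 3).over L)) * ((u : (quasiSplit (↥(maximalRealSubfield L)) L (IsCMField.complexConj L) 3).Adelic) * g)) ∂ν))) νG 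→
      -- ★ p857605's absolute convergence (`h := χ`, `F := ψ`)
        ∫⁻ g, β g * ∫⁻ u : ↥(adelicUnipotent (↥(maximalRealSubfield L)) L (IsCMField.complexConj L) 3), ‖{y : (quasiSplit (↥(maximalRealSubfield L)) L (IsCMField.complexConj L) 3).Adelic | T < borelHeight y}.indicator (flatSectionU φ' z' + flatSectionU (fun g : (quasiSplit (↥(maximalRealSubfield L)) L (IsCMField.complexConj L) 3).Adelic => (∫ v : ↥(adelicUnipotent (↥(maximalRealSubfield L)) L (IsCMField.complexConj L) 3), flatSectionU φ' z' ((quasiSplit (↥(maximalRealSubfield L)) L (IsCMField.complexConj L) 3).toAdelic (weylLongU ((IsCMField.complexConj L : L ≃ₐ[↥(maximalRealSubfield L)] L) : L →+* L) (rfl : (StdForm.antidiagonal 3).over L = (StdForm.antidiagonal 3).over L)) * ((v : (quasiSplit (↥(maximalRealSubfield L)) L (IsCMField.complexConj L) 3).Adelic) * g)) ∂ν) * ((borelHeight g : ℝ) : ℂ) ^ (z' - 2)) (2 - z')) ((quasiSplit (↥(maximalRealSubfield L)) L (IsCMField.complexConj L) 3).toAdelic (weylLongU ((IsCMField.complexConj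 L : L ≃ₐ[↥(maximalRealSubfield L)] L) : L →+* L) (rfl : (StdForm.antidiagonal 3).over L = (StdForm.antidiagonal 3).over L)) * ((u : (quasiSplit (↥(maximalRealSubfield L)) L (IsCMField.complexConj L) 3).Adelic) * g)) * conj ({y : (quasiSplit (↥(maximalRealSubfield L)) L (IsCMField.complexConj L) 3).Adelic | borelHeight y ≤ T}.indicator (flatSectionU φ z) g - {y : (quasiSplit (↥(maximalRealSubfield L)) L (IsCMField.complexConj L) 3).Adelic | T < borelHeight y}.indicator (flatSectionU (fun g : (quasiSplit (↥(maximalRealSubfield L)) L (IsCMField.complexConj L) 3).Adelic => (∫ v : ↥(adelicUnipotent (↥(maximalRealSubfield L)) L (IsCMField.complexConj L) 3), flatSectionU φ z ((quasiSplit (↥(maximalRealSubfield L)) L (IsCMField.complexConj L) 3).toAdelic (weylLongU ((IsCMField.complexConj L : L ≃ₐ[↥(maximalRealSubfield L)] L) : L →+* L) (rfl : (StdForm.antidiagonal 3).over L = (StdForm.antidiagonal 3).over L)) * ((v : (quasiSplit (↥(maximalRealSubfield L)) L (IsCMField.complexConj L) 3).Adelic) * g)) ∂ν) * ((borelHeight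 g : ℝ) : ℂ) ^ (z - 2)) (2 - z)) g)‖ₑ ∂ν ∂νG < ∞ →
        ∫⁻ g, β g * ∫⁻ u : ↥(adelicUnipotent (↥(maximalRealSubfield L)) L (IsCMField.complexConj L) 3), ‖{y : (quasiSplit (↥(maximalRealSubfield L)) L (IsCMField.complexConj L) 3).Adelic | T < borelHeight y}.indicator (flatSectionU φ' z' + flatSectionU (fun g : (quasiSplit (↥(maximalRealSubfield L)) L (IsCMField.complexConj L) 3).Adelic => (∫ v : ↥(adelicUnipotent (↥(maximalRealSubfield L)) L (IsCMField.complexConj L) 3), flatSectionU φ' z' ((quasiSplit (↥(maximalRealSubfield L)) L (IsCMField.complexConj L) 3).toAdelic (weylLongU ((IsCMField.complexConj L : L ≃ₐ[↥(maximalRealSubfield L)] L) : L →+* L) (rfl : (StdForm.antidiagonal 3).over L = (StdForm.antidiagonal 3).over L)) * ((v : (quasiSplit (↥(maximalRealSubfield L)) L (IsCMField.complexConj L) 3).Adelic) * g)) ∂ν) * ((borelHeight g : ℝ) : ℂ) ^ (z' - 2)) (2 - z')) g * conj ({y : (quasiSplit (↥(maximalRealSubfield L)) L (IsCMField.complexConj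 L) 3).Adelic | borelHeight y ≤ T}.indicator (flatSectionU φ z) (((quasiSplit (↥(maximalRealSubfield L)) L (IsCMField.complexConj L) 3).toAdelic (weylLongU ((IsCMField.complexConj L : L ≃ₐ[↥(maximalRealSubfield L)] L) : L →+* L) (rfl : (StdForm.antidiagonal 3).over L = (StdForm.antidiagonal 3).over L)))⁻¹ * ((u : (quasiSplit (↥(maximalRealSubfield L)) L (IsCMField.complexConj L) 3).Adelic) * g)) - {y : (quasiSplit (↥(maximalRealSubfield L)) L (IsCMField.complexConj L) 3).Adelic | T < borelHeight y}.indicator (flatSectionU (fun g : (quasiSplit (↥(maximalRealSubfield L)) L (IsCMField.complexConj L) 3).Adelic => (∫ v : ↥(adelicUnipotent (↥(maximalRealSubfield L)) L (IsCMField.complexConj L) 3), flatSectionU φ z ((quasiSplit (↥(maximalRealSubfield L)) L (IsCMField.complexConj L) 3).toAdelic (weylLongU ((IsCMField.complexConj L : L ≃ₐ[↥(maximalRealSubfield L)] L) : L →+* L) (rfl : (StdForm.antidiagonal 3).over L = (StdForm.antidiagonal 3).over L)) * ((v : (quasiSplit (↥(maximalRealSubfield L)) L (IsCMField.complexConj L)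 3).Adelic) * g)) ∂ν) * ((borelHeight g : ℝ) : ℂ) ^ (z - 2)) (2 - z)) (((quasiSplit (↥(maximalRealSubfield L)) L (IsCMField.complexConj L) 3).toAdelic (weylLongU ((IsCMField.complexConj L : L ≃ₐ[↥(maximalRealSubfield L)] L) : L →+* L) (rfl : (StdForm.antidiagonal 3).over L = (StdForm.antidiagonal 3).over L)))⁻¹ * ((u : (quasiSplit (↥(maximalRealSubfield L)) L (IsCMField.complexConj L) 3).Adelic) * g)))‖ₑ ∂ν ∂νG < ∞ →
      ∀ {Ξ₁ Ξ₂ Ξ₃ Ξ₄ : (AdeleRing (𝓞 L) L)ˣ → ℂ},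
      Measurable Ξ₁ → ∀ {CΞ₁ : ℝ}, (∀ x, ‖Ξ₁ x‖ ≤ CΞ₁) → (∀ k ∈ GaloisRepresentations.principalIdeles L, ∀ x, Ξ₁ (k * x) = Ξ₁ x) →
        (∀ (r : ℝ≥0ˣ) (x : (AdeleRing (𝓞 L) L)ˣ), Ξ₁ (posRealIdele L r * x) = Ξ₁ x) →
        (∀ t : torusInBorel (↥(maximalRealSubfield L)) L (IsCMField.complexConj L) 3,
          ∫ k, φ (((t : borelAdelic (↥(maximalRealSubfield L)) L (IsCMField.complexConj L) 3) : (quasiSplit (↥(maximalRealSubfield L)) L (IsCMField.complexConj L) 3).Adelic) * (k : (quasiSplit (↥(maximalRealSubfield L)) L (IsCMField.complexConj L) 3).Adelic)) *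
              conj (φ' (((t : borelAdelic (↥(maximalRealSubfield L)) L (IsCMField.complexConj L) 3) : (quasiSplit (↥(maximalRealSubfield L)) L (IsCMField.complexConj L) 3).Adelic) * (k : (quasiSplit (↥(maximalRealSubfield L)) L (IsCMField.complexConj L) 3).Adelic))) ∂μK = Ξ₁ (diagUnit (t : borelAdelic (↥(maximalRealSubfield L)) L (IsCMField.complexConj L) 3).2 0)) →
      Measurable Ξ₂ → ∀ {CΞ₂ : ℝ}, (∀ x, ‖Ξ₂ x‖ ≤ CΞ₂) → (∀ k ∈ GaloisRepresentations.principalIdeles L, ∀ x, Ξ₂ (k * x) = Ξ₂ x) →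
        (∀ (r : ℝ≥0ˣ) (x : (AdeleRing (𝓞 L) L)ˣ), Ξ₂ (posRealIdele L r * x) = Ξ₂ x) →
        (∀ t : torusInBorel (↥(maximalRealSubfield L)) L (IsCMField.complexConj L) 3,
          ∫ k, φ (((t : borelAdelic (↥(maximalRealSubfield L)) L (IsCMField.complexConj L) 3) : (quasiSplit (↥(maximalRealSubfield L)) L (IsCMField.complexConj L) 3).Adelic) * (k : (quasiSplit (↥(maximalRealSubfield L)) L (IsCMField.complexConj L) 3).Adelic)) *
              conj ((fun g : (quasiSplit (↥(maximalRealSubfield L)) L (IsCMField.complexConj L) 3).Adelic => (∫ v : ↥(adelicUnipotent (↥(maximalRealSubfield L)) L (IsCMField.complexConj L) 3), flatSectionU φ' z' ((quasiSplit (↥(maximalRealSubfield L)) L (IsCMField.complexConj L) 3).toAdelic (weylLongU ((IsCMField.complexConj L : L ≃ₐ[↥(maximalRealSubfield L)] L) : L →+* L) (rfl : (StdForm.antidiagonal 3).over L = (StdForm.antidiagonal 3).over L)) * ((v : (quasiSplit (↥(maximalRealSubfield L)) L (IsCMField.complexConj L) 3).Adelic) * g)) ∂ν) * ((borelHeight g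 : ℝ) : ℂ) ^ (z' - 2)) (((t : borelAdelic (↥(maximalRealSubfield L)) L (IsCMField.complexConj L) 3) : (quasiSplit (↥(maximalRealSubfield L)) L (IsCMField.complexConj L) 3).Adelic) * (k : (quasiSplit (↥(maximalRealSubfield L)) L (IsCMField.complexConj L) 3).Adelic))) ∂μK = Ξ₂ (diagUnit (t : borelAdelic (↥(maximalRealSubfield L)) L (IsCMField.complexConj L) 3).2 0)) →
      Measurable Ξ₃ → ∀ {CΞ₃ : ℝ}, (∀ x, ‖Ξ₃ x‖ ≤ CΞ₃) → (∀ k ∈ GaloisRepresentations.principalIdeles L, ∀ x, Ξ₃ (k * x) = Ξ₃ x) →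
        (∀ (r : ℝ≥0ˣ) (x : (AdeleRing (𝓞 L) L)ˣ), Ξ₃ (posRealIdele L r * x) = Ξ₃ x) →
        (∀ t : torusInBorel (↥(maximalRealSubfield L)) L (IsCMField.complexConj L) 3,
          ∫ k, (fun g : (quasiSplit (↥(maximalRealSubfield L)) L (IsCMField.complexConj L) 3).Adelic => (∫ v : ↥(adelicUnipotent (↥(maximalRealSubfield L)) L (IsCMField.complexConj L) 3), flatSectionU φ z ((quasiSplit (↥(maximalRealSubfield L)) L (IsCMField.complexConj L) 3).toAdelic (weylLongU ((IsCMField.complexConj L : L ≃ₐ[↥(maximalRealSubfield L)] L) : L →+* L) (rfl : (StdForm.antidiagonal 3).over L = (StdForm.antidiagonal 3).over L)) * ((v : (quasiSplit (↥(maximalRealSubfield L)) L (IsCMField.complexConj L) 3).Adelic) * g)) ∂ν) * ((borelHeight g : ℝ) : ℂ) ^ (z - 2)) (((t : borelAdelic (↥(maximalRealSubfield L)) L (IsCMField.complexConj L) 3) : (quasiSplit (↥(maximalRealSubfield L)) L (IsCMField.complexConj L) 3).Adelic) * (k : (quasiSplit (↥(maximalRealSubfield L)) L (IsCMField.complexConj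 L) 3).Adelic)) *
              conj (φ' (((t : borelAdelic (↥(maximalRealSubfield L)) L (IsCMField.complexConj L) 3) : (quasiSplit (↥(maximalRealSubfield L)) L (IsCMField.complexConj L) 3).Adelic) * (k : (quasiSplit (↥(maximalRealSubfield L)) L (IsCMField.complexConj L) 3).Adelic))) ∂μK = Ξ₃ (diagUnit (t : borelAdelic (↥(maximalRealSubfield L)) L (IsCMField.complexConj L) 3).2 0)) →
      Measurable Ξ₄ → ∀ {CΞ₄ : ℝ}, (∀ x, ‖Ξ₄ x‖ ≤ CΞ₄) → (∀ k ∈ GaloisRepresentations.principalIdeles L, ∀ x, Ξ₄ (k * x) = Ξ₄ x) →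
        (∀ (r : ℝ≥0ˣ) (x : (AdeleRing (𝓞 L) L)ˣ), Ξ₄ (posRealIdele L r * x) = Ξ₄ x) →
        (∀ t : torusInBorel (↥(maximalRealSubfield L)) L (IsCMField.complexConj L) 3,
          ∫ k, (fun g : (quasiSplit (↥(maximalRealSubfield L)) L (IsCMField.complexConj L) 3).Adelic => (∫ v : ↥(adelicUnipotent (↥(maximalRealSubfield L)) L (IsCMField.complexConj L) 3), flatSectionU φ z ((quasiSplit (↥(maximalRealSubfield L)) L (IsCMField.complexConj L) 3).toAdelic (weylLongU ((IsCMField.complexConj L : L ≃ₐ[↥(maximalRealSubfield L)] L) : L →+* L) (rfl : (StdForm.antidiagonal 3).over L = (StdForm.antidiagonal 3).over L)) * ((v : (quasiSplit (↥(maximalRealSubfield L)) L (IsCMField.complexConj L) 3).Adelic) * g)) ∂ν) * ((borelHeight g : ℝ) : ℂ) ^ (z - 2)) (((t : borelAdelic (↥(maximalRealSubfield L)) L (IsCMField.complexConj L) 3) : (quasiSplit (↥(maximalRealSubfield L)) L (IsCMField.complexConj L) 3).Adelic) * (k : (quasiSplit (↥(maximalRealSubfield L)) L (IsCMField.complexConj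 L) 3).Adelic)) *
              conj ((fun g : (quasiSplit (↥(maximalRealSubfield L)) L (IsCMField.complexConj L) 3).Adelic => (∫ v : ↥(adelicUnipotent (↥(maximalRealSubfield L)) L (IsCMField.complexConj L) 3), flatSectionU φ' z' ((quasiSplit (↥(maximalRealSubfield L)) L (IsCMField.complexConj L) 3).toAdelic (weylLongU ((IsCMField.complexConj L : L ≃ₐ[↥(maximalRealSubfield L)] L) : L →+* L) (rfl : (StdForm.antidiagonal 3).over L = (StdForm.antidiagonal 3).over L)) * ((v : (quasiSplit (↥(maximalRealSubfield L)) L (IsCMField.complexConj L) 3).Adelic) * g)) ∂ν) * ((borelHeight g : ℝ) : ℂ) ^ (z' - 2)) (((t : borelAdelic (↥(maximalRealSubfield L)) L (IsCMField.complexConj L) 3) : (quasiSplit (↥(maximalRealSubfield L)) L (IsCMField.complexConj L) 3).Adelic) * (k : (quasiSplit (↥(maximalRealSubfield L)) L (IsCMField.complexConj L) 3).Adelic))) ∂μK = Ξ₄ (diagUnit (t : borelAdelic (↥(maximalRealSubfield L)) L (IsCMField.complexConj L) 3).2 0)) →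
        ∫ x, (quasiSplit (↥(maximalRealSubfield L)) L (IsCMField.complexConj L) 3).quotFun (truncation ν 𝓕 T (eisensteinSeriesU (flatSectionU φ z))) x * conj ((quasiSplit (↥(maximalRealSubfield L)) L (IsCMField.complexConj L) 3).quotFun (truncation ν 𝓕 T (eisensteinSeriesU (flatSectionU φ' z'))) x) ∂μ =
          (cμ : ℂ) * ((K : ℂ) *
            ((((T : ℝ) : ℂ) ^ (z + conj z' - 2) / (z + conj z' - 2)) * (∫ x in {x : (AdeleRing (𝓞 L) L)ˣ | (IdeleClassGroup.ideleNorm L x : ℝ) ≤ 1} ∩ 𝓕I, ((IdeleClassGroup.ideleNorm L x : ℝ) : ℂ) * Ξ₁ x ∂νI)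
              + (((T : ℝ) : ℂ) ^ (z - conj z') / (z - conj z')) * (∫ x in {x : (AdeleRing (𝓞 L) L)ˣ | (IdeleClassGroup.ideleNorm L x : ℝ) ≤ 1} ∩ 𝓕I, ((IdeleClassGroup.ideleNorm L x : ℝ) : ℂ) * Ξ₂ x ∂νI)
              - (((T : ℝ) : ℂ) ^ (-(z - conj z')) / (z - conj z')) * (∫ x in {x : (AdeleRing (𝓞 L) L)ˣ | (IdeleClassGroup.ideleNorm L x : ℝ) ≤ 1} ∩ 𝓕I, ((IdeleClassGroup.ideleNorm L x : ℝ) : ℂ) * Ξ₃ x ∂νI)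
              - (((T : ℝ) : ℂ) ^ (-(z + conj z' - 2)) / (z + conj z' - 2)) * (∫ x in {x : (AdeleRing (𝓞 L) L)ˣ | (IdeleClassGroup.ideleNorm L x : ℝ) ≤ 1} ∩ 𝓕I, ((IdeleClassGroup.ideleNorm L x : ℝ) : ℂ) * Ξ₄ x ∂νI))) := by
  haveI := t2Space_adeleRing_of_numberField L
  haveI : T2Space (quasiSplit (↥(maximalRealSubfield L)) L (IsCMField.complexConj L) 3).Adelic := inferInstanceAs (T2Space (adelic (↥(maximalRealSubfield L)) L (IsCMField.complexConj L) 3 ((StdForm.antidiagonal 3).over L)))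
  obtain ⟨cμ, K, hcμ, hK, h6⟩ := maassSelberg_flatSectionU_three_fin (Algebra.IsQuadraticExtension.finrank_eq_two (↥(maximalRealSubfield L)) L)
    (AlgEquiv.ext fun x => IsCMField.complexConj_apply_apply L x) (IsCMField.complexConj_ne_one L) μ νG μK νI
    (exists_mem_borelAdelic_mul_mem_standardMaximalCompactGL_cm_three L) h𝓕I ν h𝓕N h𝓕1
  refine ⟨cμ, K, hcμ, hK, ?_⟩
  intro β hβ T hT φ φ' hφc hφN hφB Cφ hφC hφ'c hφ'N hφ'B Cφ' hφ'C z z' hz' hzz' M₁ hdec' hψL1 hi₅ habs habs'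
    Ξ₁ Ξ₂ Ξ₃ Ξ₄ hΞ₁m CΞ₁ hΞ₁C hΞ₁K hΞ₁M hΞ₁ hΞ₂m CΞ₂ hΞ₂C hΞ₂K hΞ₂M hΞ₂ hΞ₃m CΞ₃ hΞ₃C hΞ₃K hΞ₃M hΞ₃ hΞ₄m CΞ₄ hΞ₄C hΞ₄K hΞ₄M hΞ₄
  have hz : 2 < z.re := hz'.trans hzz'
  -- the Godement finiteness of the standard sections `H^w`, `Re w > 2`, at every `g` (★ `hfin_of_locallyUniformMajorant` + ★ R4a majorant, `𝓕` of compact closure)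
  have hstdB : ∀ w : ℂ, ∀ b ∈ borelU ((IsCMField.complexConj L : L ≃ₐ[↥(maximalRealSubfield L)] L) : L →+* L) ((StdForm.antidiagonal 3).over L), ∀ x : (quasiSplit (↥(maximalRealSubfield L)) L (IsCMField.complexConj L) 3).Adelic,
      flatSectionU (fun _ : (quasiSplit (↥(maximalRealSubfield L)) L (IsCMField.complexConj L) 3).Adelic => (1 : ℂ)) w ((quasiSplit (↥(maximalRealSubfield L)) L (IsCMField.complexConj L) 3).toAdelic b * x) = flatSectionU (fun _ : (quasiSplit (↥(maximalRealSubfield L)) L (IsCMField.complexConj L) 3).Adelic => (1 : ℂ)) w x :=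
    fun w => forall_arithmeticBorel_iff.1 fun b hb x => by rw [flatSectionU_apply, flatSectionU_apply, borelHeight_arithmeticBorel_mul hb]
  have hfin : ∀ {w : ℂ}, 2 < w.re → ∀ g : (quasiSplit (↥(maximalRealSubfield L)) L (IsCMField.complexConj L) 3).Adelic, ∫⁻ u in 𝓕, (∑' q : (quasiSplit (↥(maximalRealSubfield L)) L (IsCMField.complexConj L) 3).quotientSubgroup ⧸ (borelAdelic (↥(maximalRealSubfield L)) L (IsCMField.complexConj L) 3).subgroupOf (quasiSplit (↥(maximalRealSubfield L)) L (IsCMField.complexConj L) 3).quotientSubgroup,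
      ‖flatSectionU (fun _ : (quasiSplit (↥(maximalRealSubfield L)) L (IsCMField.complexConj L) 3).Adelic => (1 : ℂ)) w ((((q.out : (quasiSplit (↥(maximalRealSubfield L)) L (IsCMField.complexConj L) 3).quotientSubgroup) : (quasiSplit (↥(maximalRealSubfield L)) L (IsCMField.complexConj L) 3).Adelic))⁻¹ * (u : (quasiSplit (↥(maximalRealSubfield L)) L (IsCMField.complexConj L) 3).Adelic) * g)‖ₑ) ∂ν < ∞ :=
    fun {w} hw g => hfin_of_locallyUniformMajorant ν (hstdB w) (fun q => (continuous_flatSectionU continuous_const w).comp (continuous_const.mul continuous_id))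
      (exists_locallyUniform_majorant_flatSectionU_cm_three L hw (M := 1) (fun x => by rw [norm_one])) h𝓕c g
  -- `Λ′`: Borel, `G(L⁺)`-invariant, bounded modulo `hdec′` (★ p857707)
  obtain ⟨M₀, hΛbdd⟩ := exists_norm_truncation_eisensteinSeriesU_flatSectionU_le_cm_three L ν h𝓕N hT hz' hφ'c hφ'C (forall_arithmeticBorel_iff.1 hφ'B) hdec'
  exact h6 hβ hT hφc.measurable hφN hφB hφC hφ'c.measurable hφ'N hφ'B hφ'C hz' hzz' (hfin hz) (hfin hz') (fun g => summable_flatSectionU_cm_three L hz hφC g)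
    (measurable_truncation_eisensteinSeriesU_flatSectionU_cm_three' L ν 𝓕 hT hz' hφ'c hφ'C)
    (truncation_eisensteinSeriesU_flatSectionU_arithmeticSubgroup_mul ν h𝓕N T (forall_arithmeticBorel_iff.1 hφ'B) z') hΛbdd
    (fun g => integrableOn_translate_of_continuous (adelicUnipotent (↥(maximalRealSubfield L)) L (IsCMField.complexConj L) 3) ν
      (continuous_eisensteinSeriesU_flatSectionU_cm_three L hz' hφ'c hφ'C) h𝓕c g)
    hψL1 hi₅ habs habs' hΞ₁m hΞ₁C hΞ₁K hΞ₁M hΞ₁ hΞ₂m hΞ₂C hΞ₂K hΞ₂M hΞ₂ hΞ₃m hΞ₃C hΞ₃K hΞ₃M hΞ₃ hΞ₄m hΞ₄C hΞ₄K hΞ₄M hΞ₄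

open Summit.HodgeConjecture.HodgeConjecture.Cruxes.H413.K2E1MaassSelbergCMThreePairingsFin (maassSelberg_flatSectionU_three_pair)
open Summit.HodgeConjecture.HodgeConjecture.Cruxes.H413.K2E1HeisenbergHaarU3 (isInvInvariant_of_isHaarMeasure_adelicUnipotent_three locallyCompactSpace_and_secondCountableTopology_adelicUnipotent
  measure_fundamentalDomain_ne_zero_and_ne_top_three)

/-! ## §2 (ED. 2) «CM-FINAL» with the four absolute convergences PROVED (★ ED. 7 `maassSelberg_flatSectionU_three_pair`), and the structural datum `(ν, 𝓕)` EXISTS -/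

/-- **THE MAASS–SELBERG RELATION FOR FLAT SECTIONS OF `U(J₃)` AT THE CM PAIR, ED. 2**: ★ `maassSelberg_flatSectionU_cm_three_final` with the four absolute-convergence inputs `hψL1`,
`hi₅`, `habs`, `habs′` DISCHARGED (★ ED. 7 `maassSelberg_flatSectionU_three_pair` of `K2E1MaassSelbergCMThreePairingsFin` in place of ★ ED. 6; every other discharge as in ED. 1).
NAMED INPUTS EXACTLY: `hdec′` (the decay of `E(f′) − E(f′)_B` on `{H > T}`, the [D2] chain) and the `K_U`-average data `hΞ₁…hΞ₄` (the consumer's torus-character datum ★ p857588);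
the structural datum `(ν, 𝓕)` with `ν(𝓕) = 1`, compact closure, is supplied by `exists_structural_datum_cm_three` below.  Conclusion verbatim.
[cite: MoeglinWaldspurger1995, II.1.5–II.1.7 and IV.2.1–IV.2.3] [cite: Arthur1980TraceFormulaII, §4] [cite: Garrett2018, §11.3] -/
theorem maassSelberg_flatSectionU_cm_three_final'
    (μ : Measure (quasiSplit (↥(maximalRealSubfield L)) L (IsCMField.complexConj L) 3).automorphicQuotient) [(quasiSplit (↥(maximalRealSubfield L)) L (IsCMField.complexConj L) 3).IsAutomorphicMeasure μ]
    (νG : Measure (quasiSplit (↥(maximalRealSubfield L)) L (IsCMField.complexConj L) 3).Adelic) [νG.IsHaarMeasure] [νG.IsInvInvariant]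
    (μK : Measure ((standardMaximalCompactGL 3 L).comap (adelicVal (↥(maximalRealSubfield L)) L (IsCMField.complexConj L) 3 ((StdForm.antidiagonal 3).over L)) : Subgroup (quasiSplit (↥(maximalRealSubfield L)) L (IsCMField.complexConj L) 3).Adelic))
    [μK.IsHaarMeasure]
    (νI : Measure (AdeleRing (𝓞 L) L)ˣ) [νI.IsHaarMeasure]
    {𝓕I : Set (AdeleRing (𝓞 L) L)ˣ} (h𝓕I : IsIdeleClassDomain L 𝓕I)
    (ν : Measure ↥(adelicUnipotent (↥(maximalRealSubfield L)) L (IsCMField.complexConj L) 3)) [ν.IsHaarMeasure] [ν.IsInvInvariant]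
    {𝓕 : Set ↥(adelicUnipotent (↥(maximalRealSubfield L)) L (IsCMField.complexConj L) 3)} (h𝓕N : IsFundamentalDomain ↥(rationalUnipotent (↥(maximalRealSubfield L)) L (IsCMField.complexConj L) 3) 𝓕 ν) (h𝓕1 : ν 𝓕 = 1) (h𝓕c : IsCompact (closure 𝓕)) :
    ∃ cμ K : ℝ, 0 < cμ ∧ 0 < K ∧
      ∀ {β : (quasiSplit (↥(maximalRealSubfield L)) L (IsCMField.complexConj L) 3).Adelic → ℝ≥0∞}, IsCoveringWeight ((arithmeticBorel (↥(maximalRealSubfield L)) L (IsCMField.complexConj L) 3).map (quasiSplit (↥(maximalRealSubfield L)) L (IsCMField.complexConj L) 3).arithmeticSubgroup.subtype) β →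
      ∀ {T : ℝ≥0}, 1 ≤ T →
      ∀ {φ φ' : (quasiSplit (↥(maximalRealSubfield L)) L (IsCMField.complexConj L) 3).Adelic → ℂ},
      Continuous φ →
        (∀ (n : unipotentInBorel (↥(maximalRealSubfield L)) L (IsCMField.complexConj L) 3) (y : (quasiSplit (↥(maximalRealSubfield L)) L (IsCMField.complexConj L) 3).Adelic), φ (((n : borelAdelic (↥(maximalRealSubfield L)) L (IsCMField.complexConj L) 3) : (quasiSplit (↥(maximalRealSubfield L)) L (IsCMField.complexConj L) 3).Adelic) * y) = φ y) →
        (∀ b ∈ arithmeticBorel (↥(maximalRealSubfield L)) L (IsCMField.complexConj L) 3, ∀ y : (quasiSplit (↥(maximalRealSubfield L)) L (IsCMField.complexConj L) 3).Adelic, φ ((b : (quasiSplit (↥(maximalRealSubfield L)) L (IsCMField.complexConj L) 3).Adelic) * y) = φ y) →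
      ∀ {Cφ : ℝ}, (∀ x, ‖φ x‖ ≤ Cφ) →
      Continuous φ' →
        (∀ (n : unipotentInBorel (↥(maximalRealSubfield L)) L (IsCMField.complexConj L) 3) (y : (quasiSplit (↥(maximalRealSubfield L)) L (IsCMField.complexConj L) 3).Adelic), φ' (((n : borelAdelic (↥(maximalRealSubfield L)) L (IsCMField.complexConj L) 3) : (quasiSplit (↥(maximalRealSubfield L)) L (IsCMField.complexConj L) 3).Adelic) * y) = φ' y) →
        (∀ b ∈ arithmeticBorel (↥(maximalRealSubfield L)) L (IsCMField.complexConj L) 3, ∀ y : (quasiSplit (↥(maximalRealSubfield L)) L (IsCMField.complexConj L) 3).Adelic, φ' ((b : (quasiSplit (↥(maximalRealSubfield L)) L (IsCMField.complexConj L) 3).Adelic) * y) = φ' y) →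
      ∀ {Cφ' : ℝ}, (∀ x, ‖φ' x‖ ≤ Cφ') →
      ∀ {z z' : ℂ}, 2 < z'.re → z'.re < z.re →
      -- NAMED: the decay `hdec′` of `E(f′_{z′}) − E(f′_{z′})_B` on the Siegel region `{H > T}` ([D2] chain ⟹ `hΛbdd` via ★ p857707) and the `K_U`-averages `hΞ₁…hΞ₄` — NOTHING ELSE
        ∀ {M₁ : ℝ}, (∀ g : (quasiSplit (↥(maximalRealSubfield L)) L (IsCMField.complexConj L) 3).Adelic, T < borelHeight g →
          ‖eisensteinSeriesU (flatSectionU φ' z') g - borelConstantTerm ν 𝓕 (eisensteinSeriesU (flatSectionU φ' z')) g‖ ≤ M₁) →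
      ∀ {Ξ₁ Ξ₂ Ξ₃ Ξ₄ : (AdeleRing (𝓞 L) L)ˣ → ℂ},
      Measurable Ξ₁ → ∀ {CΞ₁ : ℝ}, (∀ x, ‖Ξ₁ x‖ ≤ CΞ₁) → (∀ k ∈ GaloisRepresentations.principalIdeles L, ∀ x, Ξ₁ (k * x) = Ξ₁ x) →
        (∀ (r : ℝ≥0ˣ) (x : (AdeleRing (𝓞 L) L)ˣ), Ξ₁ (posRealIdele L r * x) = Ξ₁ x) →
        (∀ t : torusInBorel (↥(maximalRealSubfield L)) L (IsCMField.complexConj L) 3,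
          ∫ k, φ (((t : borelAdelic (↥(maximalRealSubfield L)) L (IsCMField.complexConj L) 3) : (quasiSplit (↥(maximalRealSubfield L)) L (IsCMField.complexConj L) 3).Adelic) * (k : (quasiSplit (↥(maximalRealSubfield L)) L (IsCMField.complexConj L) 3).Adelic)) *
              conj (φ' (((t : borelAdelic (↥(maximalRealSubfield L)) L (IsCMField.complexConj L) 3) : (quasiSplit (↥(maximalRealSubfield L)) L (IsCMField.complexConj L) 3).Adelic) * (k : (quasiSplit (↥(maximalRealSubfield L)) L (IsCMField.complexConj L) 3).Adelic))) ∂μK = Ξ₁ (diagUnit (t : borelAdelic (↥(maximalRealSubfield L)) L (IsCMField.complexConj L) 3).2 0)) →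
      Measurable Ξ₂ → ∀ {CΞ₂ : ℝ}, (∀ x, ‖Ξ₂ x‖ ≤ CΞ₂) → (∀ k ∈ GaloisRepresentations.principalIdeles L, ∀ x, Ξ₂ (k * x) = Ξ₂ x) →
        (∀ (r : ℝ≥0ˣ) (x : (AdeleRing (𝓞 L) L)ˣ), Ξ₂ (posRealIdele L r * x) = Ξ₂ x) →
        (∀ t : torusInBorel (↥(maximalRealSubfield L)) L (IsCMField.complexConj L) 3,
          ∫ k, φ (((t : borelAdelic (↥(maximalRealSubfield L)) L (IsCMField.complexConj L) 3) : (quasiSplit (↥(maximalRealSubfield L)) L (IsCMField.complexConj L) 3).Adelic) * (k : (quasiSplit (↥(maximalRealSubfield L)) L (IsCMField.complexConj L) 3).Adelic)) *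
              conj ((fun g : (quasiSplit (↥(maximalRealSubfield L)) L (IsCMField.complexConj L) 3).Adelic => (∫ v : ↥(adelicUnipotent (↥(maximalRealSubfield L)) L (IsCMField.complexConj L) 3), flatSectionU φ' z' ((quasiSplit (↥(maximalRealSubfield L)) L (IsCMField.complexConj L) 3).toAdelic (weylLongU ((IsCMField.complexConj L : L ≃ₐ[↥(maximalRealSubfield L)] L) : L →+* L) (rfl : (StdForm.antidiagonal 3).over L = (StdForm.antidiagonal 3).over L)) * ((v : (quasiSplit (↥(maximalRealSubfield L)) L (IsCMField.complexConj L) 3).Adelic) * g)) ∂ν) * ((borelHeight g : ℝ) : ℂ) ^ (z' - 2)) (((t : borelAdelic (↥(maximalRealSubfield L)) L (IsCMField.complexConj L) 3) : (quasiSplit (↥(maximalRealSubfield L)) L (IsCMField.complexConj L) 3).Adelic) * (k : (quasiSplit (↥(maximalRealSubfield L)) L (IsCMField.complexConj L) 3).Adelic))) ∂μK = Ξ₂ (diagUnit (t : borelAdelic (↥(maximalRealSubfield L)) L (IsCMField.complexConj L) 3).2 0)) →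
      Measurable Ξ₃ → ∀ {CΞ₃ : ℝ}, (∀ x, ‖Ξ₃ x‖ ≤ CΞ₃) → (∀ k ∈ GaloisRepresentations.principalIdeles L, ∀ x, Ξ₃ (k * x) = Ξ₃ x) →
        (∀ (r : ℝ≥0ˣ) (x : (AdeleRing (𝓞 L) L)ˣ), Ξ₃ (posRealIdele L r * x) = Ξ₃ x) →
        (∀ t : torusInBorel (↥(maximalRealSubfield L)) L (IsCMField.complexConj L) 3,
          ∫ k, (fun g : (quasiSplit (↥(maximalRealSubfield L)) L (IsCMField.complexConj L) 3).Adelic => (∫ v : ↥(adelicUnipotent (↥(maximalRealSubfield L)) L (IsCMField.complexConj L) 3), flatSectionU φ z ((quasiSplit (↥(maximalRealSubfield L)) L (IsCMField.complexConj L) 3).toAdelic (weylLongU ((IsCMField.complexConj L : L ≃ₐ[↥(maximalRealSubfield L)] L) : L →+* L) (rfl : (StdForm.antidiagonal 3).over L = (StdForm.antidiagonal 3).over L)) * ((v : (quasiSplit (↥(maximalRealSubfield L)) L (IsCMField.complexConj L) 3).Adelic) * g)) ∂ν) * ((borelHeight g : ℝ) : ℂ) ^ (z - 2)) (((t : borelAdelic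 (↥(maximalRealSubfield L)) L (IsCMField.complexConj L) 3) : (quasiSplit (↥(maximalRealSubfield L)) L (IsCMField.complexConj L) 3).Adelic) * (k : (quasiSplit (↥(maximalRealSubfield L)) L (IsCMField.complexConj L) 3).Adelic)) *
              conj (φ' (((t : borelAdelic (↥(maximalRealSubfield L)) L (IsCMField.complexConj L) 3) : (quasiSplit (↥(maximalRealSubfield L)) L (IsCMField.complexConj L) 3).Adelic) * (k : (quasiSplit (↥(maximalRealSubfield L)) L (IsCMField.complexConj L) 3).Adelic))) ∂μK = Ξ₃ (diagUnit (t : borelAdelic (↥(maximalRealSubfield L)) L (IsCMField.complexConj L) 3).2 0)) →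
      Measurable Ξ₄ → ∀ {CΞ₄ : ℝ}, (∀ x, ‖Ξ₄ x‖ ≤ CΞ₄) → (∀ k ∈ GaloisRepresentations.principalIdeles L, ∀ x, Ξ₄ (k * x) = Ξ₄ x) →
        (∀ (r : ℝ≥0ˣ) (x : (AdeleRing (𝓞 L) L)ˣ), Ξ₄ (posRealIdele L r * x) = Ξ₄ x) →
        (∀ t : torusInBorel (↥(maximalRealSubfield L)) L (IsCMField.complexConj L) 3,
          ∫ k, (fun g : (quasiSplit (↥(maximalRealSubfield L)) L (IsCMField.complexConj L) 3).Adelic => (∫ v : ↥(adelicUnipotent (↥(maximalRealSubfield L)) L (IsCMField.complexConj L) 3), flatSectionU φ z ((quasiSplit (↥(maximalRealSubfield L)) L (IsCMField.complexConj L) 3).toAdelic (weylLongU ((IsCMField.complexConj L : L ≃ₐ[↥(maximalRealSubfield L)] L) : L →+* L) (rfl : (StdForm.antidiagonal 3).over L = (StdForm.antidiagonal 3).over L)) * ((v : (quasiSplit (↥(maximalRealSubfield L)) L (IsCMField.complexConj L) 3).Adelic) * g)) ∂ν) * ((borelHeight g : ℝ) : ℂ) ^ (z - 2)) (((t : borelAdelic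 (↥(maximalRealSubfield L)) L (IsCMField.complexConj L) 3) : (quasiSplit (↥(maximalRealSubfield L)) L (IsCMField.complexConj L) 3).Adelic) * (k : (quasiSplit (↥(maximalRealSubfield L)) L (IsCMField.complexConj L) 3).Adelic)) *
              conj ((fun g : (quasiSplit (↥(maximalRealSubfield L)) L (IsCMField.complexConj L) 3).Adelic => (∫ v : ↥(adelicUnipotent (↥(maximalRealSubfield L)) L (IsCMField.complexConj L) 3), flatSectionU φ' z' ((quasiSplit (↥(maximalRealSubfield L)) L (IsCMField.complexConj L) 3).toAdelic (weylLongU ((IsCMField.complexConj L : L ≃ₐ[↥(maximalRealSubfield L)] L) : L →+* L) (rfl : (StdForm.antidiagonal 3).over L = (StdForm.antidiagonal 3).over L)) * ((v : (quasiSplit (↥(maximalRealSubfield L)) L (IsCMField.complexConj L) 3).Adelic) * g)) ∂ν) * ((borelHeight g : ℝ) : ℂ) ^ (z' - 2)) (((t : borelAdelic (↥(maximalRealSubfield L)) L (IsCMField.complexConj L) 3) : (quasiSplit (↥(maximalRealSubfield L)) L (IsCMField.complexConj L) 3).Adelic) * (k : (quasiSplit (↥(maximalRealSubfield L)) L (IsCMField.complexConj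 L) 3).Adelic))) ∂μK = Ξ₄ (diagUnit (t : borelAdelic (↥(maximalRealSubfield L)) L (IsCMField.complexConj L) 3).2 0)) →
        ∫ x, (quasiSplit (↥(maximalRealSubfield L)) L (IsCMField.complexConj L) 3).quotFun (truncation ν 𝓕 T (eisensteinSeriesU (flatSectionU φ z))) x * conj ((quasiSplit (↥(maximalRealSubfield L)) L (IsCMField.complexConj L) 3).quotFun (truncation ν 𝓕 T (eisensteinSeriesU (flatSectionU φ' z'))) x) ∂μ =
          (cμ : ℂ) * ((K : ℂ) *
            ((((T : ℝ) : ℂ) ^ (z + conj z' - 2) / (z + conj z' - 2)) * (∫ x in {x : (AdeleRing (𝓞 L) L)ˣ | (IdeleClassGroup.ideleNorm L x : ℝ) ≤ 1} ∩ 𝓕I, ((IdeleClassGroup.ideleNorm L x : ℝ) : ℂ) * Ξ₁ x ∂νI)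
              + (((T : ℝ) : ℂ) ^ (z - conj z') / (z - conj z')) * (∫ x in {x : (AdeleRing (𝓞 L) L)ˣ | (IdeleClassGroup.ideleNorm L x : ℝ) ≤ 1} ∩ 𝓕I, ((IdeleClassGroup.ideleNorm L x : ℝ) : ℂ) * Ξ₂ x ∂νI)
              - (((T : ℝ) : ℂ) ^ (-(z - conj z')) / (z - conj z')) * (∫ x in {x : (AdeleRing (𝓞 L) L)ˣ | (IdeleClassGroup.ideleNorm L x : ℝ) ≤ 1} ∩ 𝓕I, ((IdeleClassGroup.ideleNorm L x : ℝ) : ℂ) * Ξ₃ x ∂νI)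
              - (((T : ℝ) : ℂ) ^ (-(z + conj z' - 2)) / (z + conj z' - 2)) * (∫ x in {x : (AdeleRing (𝓞 L) L)ˣ | (IdeleClassGroup.ideleNorm L x : ℝ) ≤ 1} ∩ 𝓕I, ((IdeleClassGroup.ideleNorm L x : ℝ) : ℂ) * Ξ₄ x ∂νI))) := by
  haveI := t2Space_adeleRing_of_numberField L
  haveI : T2Space (quasiSplit (↥(maximalRealSubfield L)) L (IsCMField.complexConj L) 3).Adelic := inferInstanceAs (T2Space (adelic (↥(maximalRealSubfield L)) L (IsCMField.complexConj L) 3 ((StdForm.antidiagonal 3).over L)))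
  obtain ⟨cμ, K, hcμ, hK, h7⟩ := maassSelberg_flatSectionU_three_pair (Algebra.IsQuadraticExtension.finrank_eq_two (↥(maximalRealSubfield L)) L)
    (AlgEquiv.ext fun x => IsCMField.complexConj_apply_apply L x) (IsCMField.complexConj_ne_one L) μ νG μK νI
    (exists_mem_borelAdelic_mul_mem_standardMaximalCompactGL_cm_three L) h𝓕I ν h𝓕N h𝓕1
  refine ⟨cμ, K, hcμ, hK, ?_⟩
  intro β hβ T hT φ φ' hφc hφN hφB Cφ hφC hφ'c hφ'N hφ'B Cφ' hφ'C z z' hz' hzz' M₁ hdec'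
    Ξ₁ Ξ₂ Ξ₃ Ξ₄ hΞ₁m CΞ₁ hΞ₁C hΞ₁K hΞ₁M hΞ₁ hΞ₂m CΞ₂ hΞ₂C hΞ₂K hΞ₂M hΞ₂ hΞ₃m CΞ₃ hΞ₃C hΞ₃K hΞ₃M hΞ₃ hΞ₄m CΞ₄ hΞ₄C hΞ₄K hΞ₄M hΞ₄
  have hz : 2 < z.re := hz'.trans hzz'
  -- the Godement finiteness of the standard sections `H^w`, `Re w > 2`, at every `g` (★ `hfin_of_locallyUniformMajorant` + ★ R4a majorant, `𝓕` of compact closure)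
  have hstdB : ∀ w : ℂ, ∀ b ∈ borelU ((IsCMField.complexConj L : L ≃ₐ[↥(maximalRealSubfield L)] L) : L →+* L) ((StdForm.antidiagonal 3).over L), ∀ x : (quasiSplit (↥(maximalRealSubfield L)) L (IsCMField.complexConj L) 3).Adelic,
      flatSectionU (fun _ : (quasiSplit (↥(maximalRealSubfield L)) L (IsCMField.complexConj L) 3).Adelic => (1 : ℂ)) w ((quasiSplit (↥(maximalRealSubfield L)) L (IsCMField.complexConj L) 3).toAdelic b * x) = flatSectionU (fun _ : (quasiSplit (↥(maximalRealSubfield L)) L (IsCMField.complexConj L) 3).Adelic => (1 : ℂ)) w x :=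
    fun w => forall_arithmeticBorel_iff.1 fun b hb x => by rw [flatSectionU_apply, flatSectionU_apply, borelHeight_arithmeticBorel_mul hb]
  have hfin : ∀ {w : ℂ}, 2 < w.re → ∀ g : (quasiSplit (↥(maximalRealSubfield L)) L (IsCMField.complexConj L) 3).Adelic, ∫⁻ u in 𝓕, (∑' q : (quasiSplit (↥(maximalRealSubfield L)) L (IsCMField.complexConj L) 3).quotientSubgroup ⧸ (borelAdelic (↥(maximalRealSubfield L)) L (IsCMField.complexConj L) 3).subgroupOf (quasiSplit (↥(maximalRealSubfield L)) L (IsCMField.complexConj L) 3).quotientSubgroup,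
      ‖flatSectionU (fun _ : (quasiSplit (↥(maximalRealSubfield L)) L (IsCMField.complexConj L) 3).Adelic => (1 : ℂ)) w ((((q.out : (quasiSplit (↥(maximalRealSubfield L)) L (IsCMField.complexConj L) 3).quotientSubgroup) : (quasiSplit (↥(maximalRealSubfield L)) L (IsCMField.complexConj L) 3).Adelic))⁻¹ * (u : (quasiSplit (↥(maximalRealSubfield L)) L (IsCMField.complexConj L) 3).Adelic) * g)‖ₑ) ∂ν < ∞ :=
    fun {w} hw g => hfin_of_locallyUniformMajorant ν (hstdB w) (fun q => (continuous_flatSectionU continuous_const w).comp (continuous_const.mul continuous_id))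
      (exists_locallyUniform_majorant_flatSectionU_cm_three L hw (M := 1) (fun x => by rw [norm_one])) h𝓕c g
  -- `Λ′`: Borel, `G(L⁺)`-invariant, bounded modulo `hdec′` (★ p857707)
  obtain ⟨M₀, hΛbdd⟩ := exists_norm_truncation_eisensteinSeriesU_flatSectionU_le_cm_three L ν h𝓕N hT hz' hφ'c hφ'C (forall_arithmeticBorel_iff.1 hφ'B) hdec'
  exact h7 hβ hT hφc.measurable hφN hφB hφC hφ'c.measurable hφ'N hφ'B hφ'C hz' hzz' (hfin hz) (hfin hz') (fun g => summable_flatSectionU_cm_three L hz hφC g)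
    (measurable_truncation_eisensteinSeriesU_flatSectionU_cm_three' L ν 𝓕 hT hz' hφ'c hφ'C)
    (truncation_eisensteinSeriesU_flatSectionU_arithmeticSubgroup_mul ν h𝓕N T (forall_arithmeticBorel_iff.1 hφ'B) z') hΛbdd
    (fun g => integrableOn_translate_of_continuous (adelicUnipotent (↥(maximalRealSubfield L)) L (IsCMField.complexConj L) 3) ν
      (continuous_eisensteinSeriesU_flatSectionU_cm_three L hz' hφ'c hφ'C) h𝓕c g)
    hΞ₁m hΞ₁C hΞ₁K hΞ₁M hΞ₁ hΞ₂m hΞ₂C hΞ₂K hΞ₂M hΞ₂ hΞ₃m hΞ₃C hΞ₃K hΞ₃M hΞ₃ hΞ₄m hΞ₄C hΞ₄K hΞ₄M hΞ₄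

omit [MeasurableSpace (AdeleRing (𝓞 L) L)ˣ] [BorelSpace (AdeleRing (𝓞 L) L)ˣ] in
/-- **THE STRUCTURAL DATUM `(ν, 𝓕)` OF ★ «CM-FINAL» EXISTS** (the multi-constraint SAT-witness asked for by the dealer K2E1-plan (g4) 06:31:04Z): a Haar measure `ν` on `N(𝔸_{L⁺})`,
inversion-invariant (★ K2-defs1 (ν-2) `isInvInvariant_of_isHaarMeasure_adelicUnipotent_three` — every Haar measure of `N(𝔸)` is), and a fundamental domain `𝓕` of `N(L⁺)` with `ν(𝓕) = 1` AND compact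
closure: `𝓕 := 𝓕_N` the Heisenberg box (★ `isFundamentalDomain_heisFundamentalDomain` for every measure, ★ `exists_isCompact_heisFundamentalDomain_subset`), `ν := ν₀(𝓕_N)⁻¹ • ν₀` for any Haar
`ν₀` (`0 < ν₀(𝓕_N) < ∞` ★ `measure_fundamentalDomain_ne_zero_and_ne_top_three`; a positive finite multiple of a Haar measure is Haar). [cite: Rogawski1990, §2.1] [cite: MoeglinWaldspurger1995, I.2.1] -/
theorem exists_structural_datum_cm_three :
    ∃ (ν : Measure ↥(adelicUnipotent (↥(maximalRealSubfield L)) L (IsCMField.complexConj L) 3)) (𝓕 : Set ↥(adelicUnipotent (↥(maximalRealSubfield L)) L (IsCMField.complexConj L) 3)),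
      ν.IsHaarMeasure ∧ ν.IsInvInvariant ∧ IsFundamentalDomain ↥(rationalUnipotent (↥(maximalRealSubfield L)) L (IsCMField.complexConj L) 3) 𝓕 ν ∧ ν 𝓕 = 1 ∧ IsCompact (closure 𝓕) := by
  have hc : IsCMField.complexConj L * IsCMField.complexConj L = 1 := AlgEquiv.ext fun x => IsCMField.complexConj_apply_apply L x
  obtain ⟨h₁, h₂⟩ := locallyCompactSpace_and_secondCountableTopology_adelicUnipotent (F := ↥(maximalRealSubfield L)) (E := L) (c := IsCMField.complexConj L) (N := 3)
  haveI := h₁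
  haveI := h₂
  letI : MeasurableSpace (AdeleRing (𝓞 L) L) := borel _
  haveI : BorelSpace (AdeleRing (𝓞 L) L) := ⟨rfl⟩
  set ν₀ : Measure ↥(adelicUnipotent (↥(maximalRealSubfield L)) L (IsCMField.complexConj L) 3) := Measure.haar with hν₀
  have h𝓕 := isFundamentalDomain_heisFundamentalDomain (F := ↥(maximalRealSubfield L)) hc ν₀
  obtain ⟨h0, htop⟩ := measure_fundamentalDomain_ne_zero_and_ne_top_three hc ν₀ h𝓕
  obtain ⟨C, hC, hsub⟩ := exists_isCompact_heisFundamentalDomain_subset (F := ↥(maximalRealSubfield L)) (E := L) (c := IsCMField.complexConj L) hc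
  haveI hH : ((ν₀ (heisFundamentalDomain (↥(maximalRealSubfield L)) L (IsCMField.complexConj L) hc))⁻¹ • ν₀).IsHaarMeasure :=
    Measure.IsHaarMeasure.smul (μ := ν₀) (cpos := ENNReal.inv_ne_zero.2 htop) (ctop := ENNReal.inv_ne_top.2 h0)
  refine ⟨(ν₀ (heisFundamentalDomain (↥(maximalRealSubfield L)) L (IsCMField.complexConj L) hc))⁻¹ • ν₀, heisFundamentalDomain (↥(maximalRealSubfield L)) L (IsCMField.complexConj L) hc,
    hH, isInvInvariant_of_isHaarMeasure_adelicUnipotent_three hc _, isFundamentalDomain_heisFundamentalDomain hc _, ?_, hC.closure_of_subset hsub⟩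
  rw [Measure.smul_apply, smul_eq_mul, ENNReal.inv_mul_cancel h0 htop]

end Summit.HodgeConjecture.HodgeConjecture.Cruxes.H413.K2E1MaassSelbergCMThreeFinal

end
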